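import Mathlib.LinearAlgebra.Matrix.Rank
import Literature.Computability.AlgebraicComplexity.BIPPaddingDegenerations
import Literature.Computability.AlgebraicComplexity.MultiplicityObstructionsProofs
import Literature.NumberTheory.DiophantineGeometry.SchurWeylPlethysmRenameProofs
import HarnessLib

/-!
# `ValuativeGCT.ValuativeFlip` (stmt-ValiantsHypothesis-12624): the flip body is upward closed in the
# inner size — size-transfer axis, part I (inner monotonicity and the steep-edge normal form)

Crux `ValuativeFlip` of route `ValuativeGCT` (wall-breaker decomposition k12/16, axis "representation-
stability transfer between sizes", 2026-08-16).  The valuative truncation `T_U(λ)` (the determinant side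
of the flip body) depends on the matrix size `m` only; the permanent side
`mult_{λ*} ℂ[Δ_m(X₀₀^{m-n} per_n)]` depends on `(n, m)`.  This file proves the one size transfer that
is a DEGENERATION and hence costs nothing:

* `paddedPerFormLex_mem_orbitClosure_of_le` — for `n ≤ n' ≤ m` the padded permanent `X₀₀^{m-n} per_n`
  is a degeneration of `X₀₀^{m-n'} per_{n'}` inside `Sym^m ℂ^{m×m}` (zero a row and a column of the
  inner block off its corner: `per_{n+1} ↦ X · per_n`; in tree as the chain
  `paddedPerPoly n m ∈ Δ[bipPaddedPerPoly (n+1) m] ⊆ Δ[paddedPerPoly (n+1) m]` of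
  `BIPPaddingDegenerations`, transported to the lexicographic variables);
* `orbitMultiplicity_paddedPer_mono_inner` — hence, by the multiplicity-obstruction principle
  (`orbitMultiplicity_le_of_mem_orbitClosure_holds`: equivariant restriction + complete
  reducibility), EVERY multiplicity of the padded permanent is monotone non-decreasing in the inner
  size `n` at fixed `m`: `mult_χ ℂ[Δ_m(X₀₀^{m-n} per_n)] ≤ mult_χ ℂ[Δ_m(X₀₀^{m-n'} per_{n'})]`, and in
  particular is bounded by the multiplicity in `ℂ[Δ_m(per_m)]` (`orbitMultiplicity_paddedPer_le_per`);
* `flipBody_mono_inner` — so the body of the crux (`∃ (U, r, δ, λ), rank ≤ r ∧ ℓ(λ) ≤ m² ∧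
  dim T_U(λ) < mult_{λ*}`) at `(n, m)` implies the body at `(n', m)` for every `n ≤ n' ≤ m`
  (flips propagate UP in `n`, i.e. toward the diagonal `m = n`), and dually the universal no-flip body
  of `NoValuativeFlip` propagates DOWN in `n` (`noFlipBody_anti_inner`);
* `forall_adm_of_forall_steep` — the generic steep-edge scheme: consequently the crux is EQUIVALENT to
  its restriction to the steep edge of each window (it suffices to flip, for each `c` and each large
  `m`, at the ONE inner size `n` that is the least admissible one, `n = n₀` or
  `2^((log₂(n-1)+c)^c) < m`); the instances by name — `valuativeFlip_iff_steep`, `headFlip_iff_steep`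
  (only `n = ⌈b m / a⌉` matters on a linear head), `tailFlip_iff_steep`, and the dual shallow-edge form
  `noValuativeFlip_iff_shallow` — are in the sequel file `…InnerMonotoneEdges` (which imports the route
  file; this one deliberately does not).

What this does NOT give (recorded in the wall-breaker's AXIS.md): a transfer that increases the padding
`m - n` at fixed `n`, or the step `m → m + 1`.  Per-side lower bounds only flow toward the diagonal
(`n ↦ n+1` here; `(n, m) ↦ (n+1, m+1)` is the padding lift, open for orbit closures), and no det-side
stability `dim T(m+1, λ + (δ)) ≤ dim T(m, λ)` is known outside Manivel's range `|λ̄| ≤ m`, where the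
per side is dominated anyway (IP17 Prop. 2.8, in tree).

Sources: Bürgisser–Ikenmeyer–Panova, J. AMS 32 (2019) §1(a) (two paddings, restriction epimorphism);
Bläser–Ikenmeyer 2025 §12.4 (multiplicity-obstruction principle); Mulmuley–Sohoni 2001 §4; this
crux's `Cruxes/ValuativeFlip/STRATEGY-CENSUS.md` (Head/Tail split, steep edge).
-/

set_option linter.dupNamespace false

namespace Summit.ValiantsHypothesis.ValiantsHypothesis.Theorems.ValuativeFlip

open scoped BigOperators Matrix
open MvPolynomial
open Literature.NumberTheory.DiophantineGeometry
open Literature.Computability.AlgebraicComplexity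

noncomputable section

/-! ## The degeneration `X₀₀^{m-n} per_n ∈ Δ_m(X₀₀^{m-n'} per_{n'})` and monotonicity of multiplicities -/

/-- **One inner step.**  For `n + 1 ≤ m`, the padded permanent `X₀₀^{m-n} per_n` lies in the orbit
closure of `X₀₀^{m-n-1} per_{n+1}` (lexicographic matrix variables): zeroing the first row and column
of the `(n+1)`-block off its corner degenerates `per_{n+1}` to `X · per_n` (in tree: the tree's
padding is a degeneration of BIP's corner padding of `per_{n+1}`, which is a degeneration of the tree's
padding of `per_{n+1}`; `BIPPaddingDegenerations`), then transport along `rename toLex`.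
[Bürgisser–Ikenmeyer–Panova 2019 §1(a); Mulmuley–Sohoni 2001 §4] -/
theorem paddedPerFormLex_mem_orbitClosure_succ {n m : ℕ} [NeZero m] (h : n + 1 ≤ m) :
    paddedPerFormLex ℂ n m ∈ orbitClosure (paddedPerFormLex ℂ (n + 1) m) := by
  have h1 : paddedPerPoly ℂ n m ∈ orbitClosure (paddedPerPoly ℂ (n + 1) m) :=
    orbitClosure_bipPaddedPerPoly_subset (n + 1) m
      (paddedPerPoly_mem_orbitClosure_bipPaddedPerPoly_succ h)
  exact (rename_mem_orbitClosure_rename_iff_holds toLex (paddedPerPoly ℂ (n + 1) m)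
    (paddedPerPoly ℂ n m)).2 h1

/-- **Inner degeneration.**  For `n ≤ n' ≤ m`, `X₀₀^{m-n} per_n ∈ Δ_m(X₀₀^{m-n'} per_{n'})`
(iterate `paddedPerFormLex_mem_orbitClosure_succ`; orbit closures are transitive,
`orbitClosure_subset_of_mem_holds`).  [Bürgisser–Ikenmeyer–Panova 2019 §1(a); Mulmuley–Sohoni 2001 §4] -/
theorem paddedPerFormLex_mem_orbitClosure_of_le {n n' m : ℕ} [NeZero m] (hnn' : n ≤ n') (hn'm : n' ≤ m) :
    paddedPerFormLex ℂ n m ∈ orbitClosure (paddedPerFormLex ℂ n' m) := by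
  obtain ⟨d, rfl⟩ := Nat.exists_eq_add_of_le hnn'
  induction d with
  | zero => simpa using mem_orbitClosure_self (paddedPerFormLex ℂ n m)
  | succ d ih =>
    have hd : n + d ≤ m := by omega
    have hstep : paddedPerFormLex ℂ (n + d) m ∈ orbitClosure (paddedPerFormLex ℂ (n + d + 1) m) :=
      paddedPerFormLex_mem_orbitClosure_succ (by omega)
    exact orbitClosure_subset_of_mem_holds hstep (ih (Nat.le_add_right n d) hd)

/-- **Inner monotonicity of padded-permanent multiplicities.**  For `n ≤ n' ≤ m` and every weight
`χ` of `GL_{m²}`: `mult_χ ℂ[Δ_m(X₀₀^{m-n} per_n)] ≤ mult_χ ℂ[Δ_m(X₀₀^{m-n'} per_{n'})]`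
(`paddedPerFormLex_mem_orbitClosure_of_le` + the multiplicity-obstruction principle
`orbitMultiplicity_le_of_mem_orbitClosure_holds`).  The determinant side of the flip body does not
depend on `n`, so this is the whole content of the size transfer `n ↦ n'` at fixed `m`.
[Bläser–Ikenmeyer 2025 §12.4; Bürgisser–Ikenmeyer–Panova 2019 §1(a)] -/
theorem orbitMultiplicity_paddedPer_mono_inner {n n' m : ℕ} [NeZero m] (hnn' : n ≤ n') (hn'm : n' ≤ m)
    (χ : Weight (MatIdx m)) :
    orbitMultiplicity ℂ (paddedPerFormLex ℂ n m) m χ ≤ orbitMultiplicity ℂ (paddedPerFormLex ℂ n' m) m χ :=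
  orbitMultiplicity_le_of_mem_orbitClosure_holds (paddedPerFormLex ℂ n' m) (paddedPerFormLex ℂ n m)
    (NeZero.ne m) (paddedPerFormLex_isHomogeneous ℂ hn'm) (paddedPerFormLex_isHomogeneous ℂ (hnn'.trans hn'm))
    (paddedPerFormLex_mem_orbitClosure_of_le hnn' hn'm) χ

/-- **The permanent dominates all its paddings**: `mult_χ ℂ[Δ_m(X₀₀^{m-n} per_n)] ≤ mult_χ ℂ[Δ_m(per_m)]`
for `n ≤ m` (`per_m = paddedPerFormLex ℂ m m`).  [Bürgisser–Ikenmeyer–Panova 2019 §1(a)] -/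
theorem orbitMultiplicity_paddedPer_le_per {n m : ℕ} [NeZero m] (hnm : n ≤ m) (χ : Weight (MatIdx m)) :
    orbitMultiplicity ℂ (paddedPerFormLex ℂ n m) m χ ≤ orbitMultiplicity ℂ (paddedPerFormLex ℂ m m) m χ :=
  orbitMultiplicity_paddedPer_mono_inner hnm le_rfl χ

/-! ## The flip body is upward closed in `n`; the no-flip body is downward closed -/

/-- **The flip body propagates up in the inner size.**  If at `(n, m)` some admissible
`(U, r, δ, λ)` has `dim T_U(λ) < mult_{λ*} ℂ[Δ_m(X₀₀^{m-n} per_n)]` (the body of `ValuativeFlip`,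
verbatim), then the same `(U, r, δ, λ)` witnesses the body at `(n', m)` for every `n ≤ n' ≤ m`: the
truncation is independent of `n` and the multiplicity is monotone in `n`
(`orbitMultiplicity_paddedPer_mono_inner`).  [this file] -/
theorem flipBody_mono_inner {n n' m : ℕ} [NeZero m] (hnn' : n ≤ n') (hn'm : n' ≤ m)
    (h : ∃ (U : Submodule ℂ (MatIdx m → ℂ)) (r δ : ℕ) (lam : Nat.Partition (m * δ)),
          (∀ u ∈ U, (Matrix.of fun a b : Fin m => u (toLex (a, b))).rank ≤ r) ∧ lam.parts.card ≤ m * m ∧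
            Module.finrank ℂ ↥(MvPolynomial.homogeneousSubmodule (MatIdx m × MatIdx m) ℂ (m * δ) ⊓
                ((MvPolynomial.vanishingIdeal ℂ
                    {p : MatIdx m × MatIdx m → ℂ | ∀ j : MatIdx m, (fun i => p (j, i)) ∈ U}) ^ (δ * (m - r))).restrictScalars ℂ ⊓
                (⨅ (M : Matrix (MatIdx m) (MatIdx m) ℂ)
                  (_ : linSubst (MatIdx m) ℂ M (detFormLex ℂ m) = detFormLex ℂ m),
                  LinearMap.ker ((MvPolynomial.aeval fun p : MatIdx m × MatIdx m =>
                      ∑ l : MatIdx m, M l p.2 •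
                        (MvPolynomial.X (p.1, l) : MvPolynomial (MatIdx m × MatIdx m) ℂ)).toLinearMap -
                    (LinearMap.id : MvPolynomial (MatIdx m × MatIdx m) ℂ →ₗ[ℂ] MvPolynomial (MatIdx m × MatIdx m) ℂ))) ⊓
                (⨅ (g : Matrix.GeneralLinearGroup (MatIdx m) ℂ) (_ : IsUpperTriangular g),
                  LinearMap.ker ((MvPolynomial.aeval fun p : MatIdx m × MatIdx m =>
                      ∑ l : MatIdx m, ((g⁻¹ : Matrix.GeneralLinearGroup (MatIdx m) ℂ) :
                        Matrix (MatIdx m) (MatIdx m) ℂ) p.1 l •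
                          (MvPolynomial.X (l, p.2) : MvPolynomial (MatIdx m × MatIdx m) ℂ)).toLinearMap -
                    weightChar ((Weight.dualOfPartition (m * m) lam).toMatIdx : Weight (MatIdx m)) g •
                      (LinearMap.id : MvPolynomial (MatIdx m × MatIdx m) ℂ →ₗ[ℂ] MvPolynomial (MatIdx m × MatIdx m) ℂ)))) <
              orbitMultiplicity ℂ (paddedPerFormLex ℂ n m) m
                ((Weight.dualOfPartition (m * m) lam).toMatIdx : Weight (MatIdx m))) :
    ∃ (U : Submodule ℂ (MatIdx m → ℂ)) (r δ : ℕ) (lam : Nat.Partition (m * δ)),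
          (∀ u ∈ U, (Matrix.of fun a b : Fin m => u (toLex (a, b))).rank ≤ r) ∧ lam.parts.card ≤ m * m ∧
            Module.finrank ℂ ↥(MvPolynomial.homogeneousSubmodule (MatIdx m × MatIdx m) ℂ (m * δ) ⊓
                ((MvPolynomial.vanishingIdeal ℂ
                    {p : MatIdx m × MatIdx m → ℂ | ∀ j : MatIdx m, (fun i => p (j, i)) ∈ U}) ^ (δ * (m - r))).restrictScalars ℂ ⊓
                (⨅ (M : Matrix (MatIdx m) (MatIdx m) ℂ)
                  (_ : linSubst (MatIdx m) ℂ M (detFormLex ℂ m) = detFormLex ℂ m),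
                  LinearMap.ker ((MvPolynomial.aeval fun p : MatIdx m × MatIdx m =>
                      ∑ l : MatIdx m, M l p.2 •
                        (MvPolynomial.X (p.1, l) : MvPolynomial (MatIdx m × MatIdx m) ℂ)).toLinearMap -
                    (LinearMap.id : MvPolynomial (MatIdx m × MatIdx m) ℂ →ₗ[ℂ] MvPolynomial (MatIdx m × MatIdx m) ℂ))) ⊓
                (⨅ (g : Matrix.GeneralLinearGroup (MatIdx m) ℂ) (_ : IsUpperTriangular g),
                  LinearMap.ker ((MvPolynomial.aeval fun p : MatIdx m × MatIdx m =>
                      ∑ l : MatIdx m, ((g⁻¹ : Matrix.GeneralLinearGroup (MatIdx m) ℂ) :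
                        Matrix (MatIdx m) (MatIdx m) ℂ) p.1 l •
                          (MvPolynomial.X (l, p.2) : MvPolynomial (MatIdx m × MatIdx m) ℂ)).toLinearMap -
                    weightChar ((Weight.dualOfPartition (m * m) lam).toMatIdx : Weight (MatIdx m)) g •
                      (LinearMap.id : MvPolynomial (MatIdx m × MatIdx m) ℂ →ₗ[ℂ] MvPolynomial (MatIdx m × MatIdx m) ℂ)))) <
              orbitMultiplicity ℂ (paddedPerFormLex ℂ n' m) m
                ((Weight.dualOfPartition (m * m) lam).toMatIdx : Weight (MatIdx m)) := by
  obtain ⟨U, r, δ, lam, hU, hcard, hlt⟩ := h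
  exact ⟨U, r, δ, lam, hU, hcard, lt_of_lt_of_le hlt (orbitMultiplicity_paddedPer_mono_inner hnn' hn'm _)⟩

/-- **The no-flip body propagates down in the inner size.**  If at `(n, m)` (`n ≤ m`) every
admissible `(U, r, δ, λ)` has `mult_{λ*} ℂ[Δ_m(X₀₀^{m-n} per_n)] ≤ dim T_U(λ)` (the body of
`NoValuativeFlip`, verbatim), then the same holds at `(n', m)` for every `n' ≤ n`.  [this file] -/
theorem noFlipBody_anti_inner {n n' m : ℕ} [NeZero m] (hn'n : n' ≤ n) (hnm : n ≤ m)
    (h : ∀ (U : Submodule ℂ (MatIdx m → ℂ)) (r : ℕ),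
      (∀ u ∈ U, (Matrix.of fun a b : Fin m => u (toLex (a, b))).rank ≤ r) →
        ∀ (δ : ℕ) (lam : Nat.Partition (m * δ)), lam.parts.card ≤ m * m →
          orbitMultiplicity ℂ (paddedPerFormLex ℂ n m) m
                ((Weight.dualOfPartition (m * m) lam).toMatIdx : Weight (MatIdx m)) ≤
            Module.finrank ℂ ↥(MvPolynomial.homogeneousSubmodule (MatIdx m × MatIdx m) ℂ (m * δ) ⊓
                ((MvPolynomial.vanishingIdeal ℂ
                    {p : MatIdx m × MatIdx m → ℂ | ∀ j : MatIdx m, (fun i => p (j, i)) ∈ U}) ^ (δ * (m - r))).restrictScalars ℂ ⊓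
                (⨅ (M : Matrix (MatIdx m) (MatIdx m) ℂ)
                  (_ : linSubst (MatIdx m) ℂ M (detFormLex ℂ m) = detFormLex ℂ m),
                  LinearMap.ker ((MvPolynomial.aeval fun p : MatIdx m × MatIdx m =>
                      ∑ l : MatIdx m, M l p.2 •
                        (MvPolynomial.X (p.1, l) : MvPolynomial (MatIdx m × MatIdx m) ℂ)).toLinearMap -
                    (LinearMap.id : MvPolynomial (MatIdx m × MatIdx m) ℂ →ₗ[ℂ] MvPolynomial (MatIdx m × MatIdx m) ℂ))) ⊓
                (⨅ (g : Matrix.GeneralLinearGroup (MatIdx m) ℂ) (_ : IsUpperTriangular g),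
                  LinearMap.ker ((MvPolynomial.aeval fun p : MatIdx m × MatIdx m =>
                      ∑ l : MatIdx m, ((g⁻¹ : Matrix.GeneralLinearGroup (MatIdx m) ℂ) :
                        Matrix (MatIdx m) (MatIdx m) ℂ) p.1 l •
                          (MvPolynomial.X (l, p.2) : MvPolynomial (MatIdx m × MatIdx m) ℂ)).toLinearMap -
                    weightChar ((Weight.dualOfPartition (m * m) lam).toMatIdx : Weight (MatIdx m)) g •
                      (LinearMap.id : MvPolynomial (MatIdx m × MatIdx m) ℂ →ₗ[ℂ] MvPolynomial (MatIdx m × MatIdx m) ℂ))))) :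
    ∀ (U : Submodule ℂ (MatIdx m → ℂ)) (r : ℕ),
      (∀ u ∈ U, (Matrix.of fun a b : Fin m => u (toLex (a, b))).rank ≤ r) →
        ∀ (δ : ℕ) (lam : Nat.Partition (m * δ)), lam.parts.card ≤ m * m →
          orbitMultiplicity ℂ (paddedPerFormLex ℂ n' m) m
                ((Weight.dualOfPartition (m * m) lam).toMatIdx : Weight (MatIdx m)) ≤
            Module.finrank ℂ ↥(MvPolynomial.homogeneousSubmodule (MatIdx m × MatIdx m) ℂ (m * δ) ⊓
                ((MvPolynomial.vanishingIdeal ℂ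
                    {p : MatIdx m × MatIdx m → ℂ | ∀ j : MatIdx m, (fun i => p (j, i)) ∈ U}) ^ (δ * (m - r))).restrictScalars ℂ ⊓
                (⨅ (M : Matrix (MatIdx m) (MatIdx m) ℂ)
                  (_ : linSubst (MatIdx m) ℂ M (detFormLex ℂ m) = detFormLex ℂ m),
                  LinearMap.ker ((MvPolynomial.aeval fun p : MatIdx m × MatIdx m =>
                      ∑ l : MatIdx m, M l p.2 •
                        (MvPolynomial.X (p.1, l) : MvPolynomial (MatIdx m × MatIdx m) ℂ)).toLinearMap -
                    (LinearMap.id : MvPolynomial (MatIdx m × MatIdx m) ℂ →ₗ[ℂ] MvPolynomial (MatIdx m × MatIdx m) ℂ))) ⊓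
                (⨅ (g : Matrix.GeneralLinearGroup (MatIdx m) ℂ) (_ : IsUpperTriangular g),
                  LinearMap.ker ((MvPolynomial.aeval fun p : MatIdx m × MatIdx m =>
                      ∑ l : MatIdx m, ((g⁻¹ : Matrix.GeneralLinearGroup (MatIdx m) ℂ) :
                        Matrix (MatIdx m) (MatIdx m) ℂ) p.1 l •
                          (MvPolynomial.X (l, p.2) : MvPolynomial (MatIdx m × MatIdx m) ℂ)).toLinearMap -
                    weightChar ((Weight.dualOfPartition (m * m) lam).toMatIdx : Weight (MatIdx m)) g •
                      (LinearMap.id : MvPolynomial (MatIdx m × MatIdx m) ℂ →ₗ[ℂ] MvPolynomial (MatIdx m × MatIdx m) ℂ)))) :=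
  fun U r hU δ lam hcard =>
    (orbitMultiplicity_paddedPer_mono_inner hn'n hnm _).trans (h U r hU δ lam hcard)

/-! ## Steep-edge normal forms -/

/-- **Generic steep-edge scheme.**  If a predicate `P n m` is upward closed in `n ≤ m`, then to have
`P n m` for all `n ≥ n₀` and all admissible `(n, m)` it suffices to have it at those admissible
`(n, m)` for which no SMALLER `n' ≥ n₀` is admissible for the same `m` (the steepest inner size).
[this file; elementary] -/
theorem forall_adm_of_forall_steep {P Adm : ℕ → ℕ → Prop} {n₀ : ℕ}
    (hmono : ∀ n n' m, n ≤ n' → n' ≤ m → P n m → P n' m)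
    (h : ∀ n, n₀ ≤ n → ∀ m, n ≤ m → Adm n m → (∀ n', n₀ ≤ n' → n' < n → ¬ Adm n' m) → P n m) :
    ∀ n, n₀ ≤ n → ∀ m, n ≤ m → Adm n m → P n m := by
  classical
  intro n hn m hnm hadm
  have hex : ∃ n', n₀ ≤ n' ∧ Adm n' m := ⟨n, hn, hadm⟩
  set n₁ := Nat.find hex with hn₁
  obtain ⟨hn₁₀, hadm₁⟩ : n₀ ≤ n₁ ∧ Adm n₁ m := Nat.find_spec hex
  have hn₁n : n₁ ≤ n := Nat.find_min' hex ⟨hn, hadm⟩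
  refine hmono n₁ n m hn₁n hnm (h n₁ hn₁₀ m (hn₁n.trans hnm) hadm₁ fun n' hn' hlt hadm' => ?_)
  exact Nat.find_min hex hlt ⟨hn', hadm'⟩

/-- The quasi-polynomial window bound `W_c(n) = 2^((log₂ n + c)^c)` is monotone in `n`. [folklore] -/
theorem window_mono (c : ℕ) {n n' : ℕ} (h : n ≤ n') :
    2 ^ ((Nat.log 2 n + c) ^ c) ≤ 2 ^ ((Nat.log 2 n' + c) ^ c) :=
  Nat.pow_le_pow_right (by norm_num)
    (Nat.pow_le_pow_left (Nat.add_le_add_right (Nat.log_mono_right h) c) c)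

end

end Summit.ValiantsHypothesis.ValiantsHypothesis.Theorems.ValuativeFlip
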